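import Literature.IUT.HodgeTheaters.Cor53iModelRatioTransport
import Literature.IUT.HodgeTheaters.Cor53iArithHratOfMonoidRigidity
import Literature.IUT.HodgeTheaters.GlobalFrobenioidsArithmeticWhiskeredCor411
import Literature.AlgebraicGeometry.Frobenioids.ArithmeticDivisorsMonoidIsoPlaces
import HarnessLib

/-!
# [IUTchI] Cor 5.3 (i) / Ex 5.1 (v) at the GENUINE `ℱ^⊛(†𝒟^⊚)`: a self-equivalence over the identity of `†𝒟^⊛` acts on
# the rational functions through ONE natural Galois-equivariant automorphism `ᾱ` of `𝔹 = (A ↦ (F̄^{H_A})^×)` which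
# relabels the finite primes on principal divisors — the binder `hB` (𝔹-RATIO) REDUCED to «such an `ᾱ` is the identity»

S. Mochizuki, *Inter-universal Teichmüller theory I*, kurims manuscript (May 2020), §5 Cor 5.3 (i) p. 144 l. 2–11, proof
l. 24–33 («follows immediately from the category-theoreticity of the "isomorphism `𝕄^⊛(†𝒟^⊚) ⥲ †𝕄^⊛`" of Example 5.1, (v)»);
Ex 5.1 (v) pp. 127–128 ([IUTchI] Cor 5.3 (i) p.144; Ex 5.1 (v) p.128) [claim: Mochizuki2012, status: disputed] (D-0012 claim
key; nothing of the series is asserted; no side taken on [IUTchIII] Cor. 3.12).  The mathematics is [FrdI]: S. Mochizuki, *The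
geometry of Frobenioids I*, Kyushu J. Math. **62** (2008), Cor 4.10 p. 90, Cor 4.11 (ii)–(iv) pp. 91–92, Thm 5.2 (ii) p. 101,
Ex 6.3 p. 113 [cite: MochizukiFrdI2008, Thm. 5.2 (ii) p.101].

PROOF-ONLY (cell abc-iut, seat abc-iut-L5-t11 gen 17, row «C411-UNITS@ARITH» = BRATIO split (a) of GAP D-G-L5t11g16-2,
abc-iut-L5-lead RULINGS #161 (4); 0 def / 0 instance / 0 notation / no Prop fact).  STATE OF RECORD: ★
`Cor53iArithHratOfMonoidRigidity` closes `hker⊛` at `ℱ^⊛(†𝒟^⊚)` from Φ-RIGID-PRINC (PROVED, abc-iut-L5-t1 R82) and the ONE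
displayed binder `hB` = 𝔹-RATIO: «every self-equivalence `Ψ` of `ℱ^⊛(†𝒟^⊚)` over the identity of `†𝒟^⊛` preserves, through
some base identification `η`, the rational function `u_f/u_g ∈ 𝔹(A) = K_A^×` of every pair of parallel linear arrows»
(print's Ex 5.1 (v), FACT-SHAPE ≙ F-2577).  THIS FILE proves the CATEGORICAL half of `hB` with NO hypothesis:

* § 1 **`Cor53.arith_exists_unitsAut_of_overBase (Ψ) (η)`** — for EVERY `Ψ` and EVERY `η : Ψ ⋙ Base ≅ Base` there is a
  family of automorphisms `ᾱ_A : 𝔹(A) ⥲ 𝔹(A)`, `A ∈ Ob(†𝒟^⊛) = ℬ(G_F)⁰`, (1) NATURAL along every arrow of `ℬ(G_F)⁰` (restrictions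
  AND Galois conjugations: `ᾱ` is ONE Galois-equivariant automorphism of the functor `A ↦ (F̄^{H_A})^×`), (2) compatible with `Div`
  through a MONOID AUTOMORPHISM `ε_A` of the effective arithmetic divisors `Φ^⊛(A) = EffArithDivisor(K_A)`, and (3) satisfying
  `u_{Ψ f} · η_X^*(ᾱ(u_g)) = u_{Ψ g} · η_X^*(ᾱ(u_f))` for all parallel linear `f, g` — the (hratio) clause of `hB` VERBATIM with
  `ᾱ` inserted.  It is this seat's generic engine ★ `ModelFrobenioid.exists_unitsAut_of_selfEquivalence_over_baseIso`
  ([FrdI] Cor 4.10 `Ψ^birat` + Thm 5.2 (ii) `𝒪^×(A^birat) ≅ 𝔹(A_D)` at EVERY object + uniqueness of intertwiners along linear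
  arrows) with EVERY hypothesis discharged at the arithmetic model: [FrdI] Thm 3.4 (ii) (`FrdI.thm34ii_ofFunctor`, standard
  type ✓ `isOfStandardType_arith`), Cor 4.11 (iii) (`preservesDegFr_arith`), Thm 4.9 / Cor 4.11 (iii) `Ψ^Φ` over `Ψ`
  (`FrdI.exists_divisorMonoidIsoOver_div_ofFunctor`, perf-factorial ✓, rational ✓, `cor411Setting_arith` ✓), isotropic type ✓,
  `𝔹` group-like ✓, `Φ^⊛` divisorial ✓.
* § 0 `Cor53.model_exists_unitsAut_of_overBase` — the same at ANY model `ℱ(Δ)` over `ℬ(G)⁰` with the [FrdI] inputs displayed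
  (Frobenioid, standard type, perf-factorial, rational, `Cor411Setting`, `deg_Fr` preserved, `𝔹` group-like, `Φ` divisorial);
  § 1 is its one-line instance, and § 1⊚ **`Cor53.whisker_exists_unitsAut_of_overBase (S) (hZ)`** the instance at the WHISKERED
  data `(Φ^⊛ ∘ S, 𝔹 ∘ S, Div ∘ S)` over `ℬ(H)⁰`, `H` slim — the carrier of the `hB⊚` binder of ★ `Cor53iFcircHkerTransport` («resp.
  `⊚`») — every input from this seat's ★ `GlobalFrobenioidsArithmeticWhiskeredCor411`.
* § 2 `EffArithDivisor.exists_perm_ordFin_of_divisor_law` (classical bookkeeping on [FrdI] Ex 6.3's data) and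
  **`Cor53.arith_exists_unitsAut_ordFin_of_overBase`** — the Div-law read on the FINITE primes: at every `A` a permutation
  `π_A` of the finite places of `K_A` with `ord_{π_A w}(ᾱ_A u) = ord_w(u)` for all `u ∈ K_A^×` (structure theorem for monoid
  automorphisms of `EffArithDivisor`, abc-iut-L1's `exists_decomposition_mulEquiv`; the archimedean factor is discarded).

WHAT REMAINS of `hB` after this file (honest): the NUMBER-THEORETIC half «a Galois-equivariant automorphism of `F̄^×`
stabilising every `K_A^×` and relabelling the finite primes on principal divisors is the identity» (row «BRIGID-KUMMER»,
abc-iut-L5-t16 ★ `UnitsFunctorAutRigidity`; Kummer theory + finiteness of the class group), its transport from `FinSubextCat F F̄`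
to `ℬ(G_F)⁰` along the Galois correspondence, and the knit `ᾱ = 1 ⇒ hB` (η := the given one); for `hB⊚` along an `S` that is not
essentially surjective the number-theoretic half is NOT claimed.  Nothing here asserts those; nothing here asserts abc proved or refuted.
-/

noncomputable section

set_option backward.isDefEq.respectTransparency false

/-! ### § 2a. Classical bookkeeping: a divisor law through a monoid automorphism relabels the finite primes -/

namespace Literature.AlgebraicGeometry.Frobenioids

namespace EffArithDivisor

open NumberField

variable {K : Type} [Field K] [NumberField K]

/-- **A divisor law `div(α u) = ε^gp(div u)` through a MONOID automorphism `ε` of the effective arithmetic divisors relabels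
the finite primes**: there is a permutation `π` of the finite places with `ord_{π w}(α u) = ord_w(u)` for all `u ∈ K^×`
([FrdI] Ex 6.3 data; Thm 6.4 (iv) structure of `ε`: `ε(f, t) = (π_* f, g t)`, abc-iut-L1's `exists_decomposition_mulEquiv`).
[cite: MochizukiFrdI2008, Ex. 6.3 p.113] -/
theorem exists_perm_ordFin_of_divisor_law
    (ε : Multiplicative (EffArithDivisor K) ≃* Multiplicative (EffArithDivisor K)) (α : Kˣ → Kˣ)
    (h : ∀ u : Kˣ, (EffArithDivisor.gpEquiv K).symm (principalArithDivisorHom K (α u)) =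
      MonGp.map ε.toMonoidHom ((EffArithDivisor.gpEquiv K).symm (principalArithDivisorHom K u))) :
    ∃ π : Equiv.Perm (FinitePlace K), ∀ (u : Kˣ) (w : FinitePlace K), ordFin K (π w) (α u) = ordFin K w u := by
  obtain ⟨π, g, -, hD⟩ := exists_decomposition_mulEquiv ε
  refine ⟨π, fun u w => ?_⟩
  obtain ⟨D₁, D₂, hd⟩ := ArithDivisor.exists_sub_eq K (principalArithDivisor K u)
  have hu : principalArithDivisorHom K u =
      Multiplicative.ofAdd (toArithDivisor K D₁) / Multiplicative.ofAdd (toArithDivisor K D₂) := by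
    rw [← ofAdd_sub, hd]; rfl
  have h' := congrArg (EffArithDivisor.gpEquiv K) (h u)
  rw [MulEquiv.apply_symm_apply, hu, map_div, gpEquiv_symm_ofAdd_toArithDivisor, gpEquiv_symm_ofAdd_toArithDivisor,
    map_div, MonGp.map_of, MonGp.map_of, map_div, EffArithDivisor.gpEquiv_apply, EffArithDivisor.gpEquiv_apply,
    EffArithDivisor.gpHom_of, EffArithDivisor.gpHom_of, MulEquiv.coe_toMonoidHom, hD, hD, toAdd_ofAdd, toAdd_ofAdd,
    ← ofAdd_sub] at h'
  have h₁ := congrArg (fun d : Multiplicative (ArithDivisor K) => (Multiplicative.toAdd d).1 (π w)) h'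
  have h₂ := congrArg (fun d : ArithDivisor K => d.1 w) hd
  simp only [toAdd_ofAdd, Prod.fst_sub, Finsupp.coe_sub, Pi.sub_apply, toArithDivisor_fst,
    Finsupp.equivMapDomain_apply, Equiv.symm_apply_apply, principalArithDivisor_fst] at h₁ h₂
  rw [← h₂]
  exact h₁

end EffArithDivisor

end Literature.AlgebraicGeometry.Frobenioids

namespace Literature.IUT.HodgeTheaters

open CategoryTheory Opposite NumberField Literature.AlgebraicGeometry.Frobenioids
open Literature.AlgebraicGeometry.Frobenioids.QuasiTemperoid Literature.AlgebraicGeometry.Frobenioids.PreFrobenioid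

namespace Cor53

/-! ### § 0. At ANY model `ℱ(Δ)` of global divisor data over `ℬ(G)⁰`, the model inputs displayed -/

section Model

variable {G : ProfiniteGrp.{0}} (Δ : GlobalDivisorData G)

/-- **[IUTchI] Cor 5.3 (i) / Ex 5.1 (v), categorical half of 𝔹-RATIO at ANY model `ℱ(Δ)` over `ℬ(G)⁰`** — this seat's generic
[FrdI] Cor 4.10 / Thm 5.2 (ii) engine ★ `ModelFrobenioid.exists_unitsAut_of_selfEquivalence_over_baseIso` with the [FrdI] inputs
DISPLAYED as the hypotheses the cell's Cor 4.11 files discharge at each carrier (`ℱ^⊛(†𝒟^⊚)`: § 1; the whiskered data of the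
`⊚`-slot: § 1⊚): `hF` Frobenioid, `hstd` standard type (⇒ [FrdI] Thm 3.4 (ii) `FrdI.thm34ii_ofFunctor`: `Ψ^{±1}` preserve
co-angular pre-steps), `hpf` perf-factorial + `hrat` rational + `hset` `Cor411Setting` (⇒ Thm 4.9 / Cor 4.11 (iii) `Ψ^Φ` over `Ψ`,
`FrdI.exists_divisorMonoidIsoOver_div_ofFunctor`), `hdeg` ([FrdI] Cor 4.11 (iii)), `hBg`/`hΦd` ([FrdI] Thm 5.2 hypotheses).  For
`Ψ` over the base through `η`: ONE natural automorphism `ᾱ` of `𝔹`, Div-compatible through monoid automorphisms of `Φ(A)`, with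
the (hratio) clause of `hB` WITH `ᾱ` INSERTED.
([IUTchI] Cor 5.3 (i) p.144; Ex 5.1 (v) p.128) [cite: MochizukiFrdI2008, Cor. 4.10 p.90] [claim: Mochizuki2012, status: disputed] -/
theorem model_exists_unitsAut_of_overBase (hF : PreFrobenioid.IsFrobenioid (ModelFrobenioid.toElem Δ.Φ Δ.B Δ.div))
    (hstd : (ModelFrobenioid.data Δ.Φ Δ.B Δ.div).IsOfStandardType)
    (hpf : Objectwise (fun M _ => IsPerfFactorial M) Δ.Φ)
    (hrat : ∀ A : Δ.ModelGlobalFrobenioid, PreFrobenioidData.IsRational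
      (biratData hF (hasBiratSquares_of_isFrobenioid hF)) (S := ModelFrobenioid.data Δ.Φ Δ.B Δ.div) (fun a 𝔭 => PrimarySupp a 𝔭) A)
    (hBg : Objectwise (fun M _ => IsGroupLike M) Δ.B) (hΦd : Objectwise (fun M _ => IsDivisorial M) Δ.Φ)
    (Ψ : Δ.ModelGlobalFrobenioid ≌ Δ.ModelGlobalFrobenioid)
    (hset : (ModelFrobenioid.data Δ.Φ Δ.B Δ.div).Cor411Setting (ModelFrobenioid.data Δ.Φ Δ.B Δ.div) Ψ)
    (hdeg : PreFrobenioidData.PreservesDegFr (ModelFrobenioid.data Δ.Φ Δ.B Δ.div) (ModelFrobenioid.data Δ.Φ Δ.B Δ.div) Ψ)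
    (η : Ψ.functor ⋙ Δ.modelBase ≅ Δ.modelBase) :
    ∃ ᾱ : ∀ A : BaseCat G, Δ.B.obj (op A) ≃* Δ.B.obj (op A),
      (∀ ⦃A' A : BaseCat G⦄ (g : A' ⟶ A) (w : Δ.B.obj (op A)), ᾱ A' (pull Δ.B g w) = pull Δ.B g (ᾱ A w)) ∧
      (∀ A : BaseCat G, ∃ ε : Δ.Φ.obj (op A) ≃* Δ.Φ.obj (op A), ∀ w : Δ.B.obj (op A),
        divB Δ.Φ Δ.B Δ.div (op A) (ᾱ A w) = MonGp.map ε.toMonoidHom (divB Δ.Φ Δ.B Δ.div (op A) w)) ∧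
      ∀ ⦃X Y : Δ.ModelGlobalFrobenioid⦄ (f g : X ⟶ Y), ModelFrobenioid.degFr f = 1 → ModelFrobenioid.degFr g = 1 →
        ModelFrobenioid.baseMap f = ModelFrobenioid.baseMap g →
          ModelFrobenioid.unit (Ψ.functor.map f) *
              pull Δ.B (A := X.base) (B := (Ψ.functor.obj X).base) (η.hom.app X) (ᾱ X.base (ModelFrobenioid.unit g)) =
            ModelFrobenioid.unit (Ψ.functor.map g) *
              pull Δ.B (A := X.base) (B := (Ψ.functor.obj X).base) (η.hom.app X) (ᾱ X.base (ModelFrobenioid.unit f)) := by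
  -- [FrdI] Thm 3.4 (ii): `Ψ^{±1}` preserve co-angular pre-steps
  obtain ⟨-, hca, -⟩ := FrdI.thm34ii_ofFunctor hF hF Ψ hstd.quasiIsotropic hstd.quasiIsotropic hstd.fsmff hstd.fsmff
  obtain ⟨-, hca', -⟩ :=
    FrdI.thm34ii_ofFunctor hF hF Ψ.symm hstd.quasiIsotropic hstd.quasiIsotropic hstd.fsmff hstd.fsmff
  have hΨ : ∀ ⦃A A' : Δ.ModelGlobalFrobenioid⦄ (f : A ⟶ A'),
      PreFrobenioid.IsCoAngularPreStep (ModelFrobenioid.toElem Δ.Φ Δ.B Δ.div) f →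
        PreFrobenioid.IsCoAngularPreStep (ModelFrobenioid.toElem Δ.Φ Δ.B Δ.div) (Ψ.functor.map f) :=
    fun A A' f hf => (PreFrobenioidData.ofFunctor_isCoAngularPreStep _ _).mp
      (hca f ((PreFrobenioidData.ofFunctor_isCoAngularPreStep _ _).mpr hf))
  have hΨ' : ∀ ⦃A A' : Δ.ModelGlobalFrobenioid⦄ (f : A ⟶ A'),
      PreFrobenioid.IsCoAngularPreStep (ModelFrobenioid.toElem Δ.Φ Δ.B Δ.div) f →
        PreFrobenioid.IsCoAngularPreStep (ModelFrobenioid.toElem Δ.Φ Δ.B Δ.div) (Ψ.inverse.map f) :=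
    fun A A' f hf => (PreFrobenioidData.ofFunctor_isCoAngularPreStep _ _).mp
      (hca' f ((PreFrobenioidData.ofFunctor_isCoAngularPreStep _ _).mpr hf))
  -- [FrdI] Thm 4.9 / Cor 4.11 (iii): `Ψ^Φ` over `Ψ` with the divisor clause on all arrows
  obtain ⟨ΨΦ, hdiv⟩ := FrdI.exists_divisorMonoidIsoOver_div_ofFunctor hF hF hpf hpf hrat Ψ hset
  exact ModelFrobenioid.exists_unitsAut_of_selfEquivalence_over_baseIso hBg hΦd hF
    (ModelFrobenioid.isOfIsotropicType hBg) Ψ hΨ hΨ' hdeg ΨΦ hdiv η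

end Model

section Arith

variable (F : Type) [Field F] [NumberField F]

/-! ### § 1. The categorical half of 𝔹-RATIO at `ℱ^⊛(†𝒟^⊚)`, hypothesis-free -/

/-- **[IUTchI] Cor 5.3 (i) / Ex 5.1 (v) at `ℱ^⊛(†𝒟^⊚)` — every self-equivalence over the identity of `†𝒟^⊛` acts on the
rational functions through ONE natural automorphism `ᾱ` of `𝔹`.**  For every `Ψ : ℱ^⊛(†𝒟^⊚) ⥲ ℱ^⊛(†𝒟^⊚)` and every
`η : Ψ ⋙ Base ≅ Base` there are automorphisms `ᾱ_A : 𝔹(A) ⥲ 𝔹(A) = ((F̄^{H_A})^× ⥲ (F̄^{H_A})^×)`, `A ∈ Ob(ℬ(G_F)⁰)`, with: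
(1) naturality along every arrow `g : A′ → A` of `ℬ(G_F)⁰` (`ᾱ_{A′} ∘ g^* = g^* ∘ ᾱ_A` — restriction to subfields AND Galois
conjugation); (2) at every `A` a MONOID AUTOMORPHISM `ε_A` of `Φ^⊛(A) = EffArithDivisor(K_A)` with `Div ∘ ᾱ_A = ε_A^gp ∘ Div`;
(3) for all parallel linear `f, g : X → Y`: `u_{Ψ f} · η_X^*(ᾱ_{X_D}(u_g)) = u_{Ψ g} · η_X^*(ᾱ_{X_D}(u_f))` — ★ p525667's `hB`
clause with `ᾱ` inserted (`ᾱ = 1` IS that clause with this `η`).  [FrdI] Cor 4.10 + Thm 5.2 (ii) (this seat's generic ★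
`ModelFrobenioid.exists_unitsAut_of_selfEquivalence_over_baseIso`), every hypothesis discharged: Thm 3.4 (ii), Cor 4.11 (iii),
Thm 4.9's `Ψ^Φ`, isotropic/standard type of `ℱ^⊛(†𝒟^⊚)`.
([IUTchI] Cor 5.3 (i) p.144; Ex 5.1 (v) p.128) [cite: MochizukiFrdI2008, Cor. 4.10 p.90] [claim: Mochizuki2012, status: disputed] -/
theorem arith_exists_unitsAut_of_overBase
    (Ψ : (GlobalDivisorData.arith F).ModelGlobalFrobenioid ≌ (GlobalDivisorData.arith F).ModelGlobalFrobenioid)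
    (η : Ψ.functor ⋙ (GlobalDivisorData.arith F).modelBase ≅ (GlobalDivisorData.arith F).modelBase) :
    ∃ ᾱ : ∀ A : BaseCat (absGalGrp F), (GlobalDivisorData.arith F).B.obj (op A) ≃* (GlobalDivisorData.arith F).B.obj (op A),
      (∀ ⦃A' A : BaseCat (absGalGrp F)⦄ (g : A' ⟶ A) (w : (GlobalDivisorData.arith F).B.obj (op A)),
        ᾱ A' (pull (GlobalDivisorData.arith F).B g w) = pull (GlobalDivisorData.arith F).B g (ᾱ A w)) ∧
      (∀ A : BaseCat (absGalGrp F),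
        ∃ ε : (GlobalDivisorData.arith F).Φ.obj (op A) ≃* (GlobalDivisorData.arith F).Φ.obj (op A),
          ∀ w : (GlobalDivisorData.arith F).B.obj (op A),
            divB (GlobalDivisorData.arith F).Φ (GlobalDivisorData.arith F).B (GlobalDivisorData.arith F).div (op A) (ᾱ A w) =
              MonGp.map ε.toMonoidHom
                (divB (GlobalDivisorData.arith F).Φ (GlobalDivisorData.arith F).B (GlobalDivisorData.arith F).div (op A) w)) ∧
      ∀ ⦃X Y : (GlobalDivisorData.arith F).ModelGlobalFrobenioid⦄ (f g : X ⟶ Y), ModelFrobenioid.degFr f = 1 →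
        ModelFrobenioid.degFr g = 1 → ModelFrobenioid.baseMap f = ModelFrobenioid.baseMap g →
          ModelFrobenioid.unit (Ψ.functor.map f) *
              pull (GlobalDivisorData.arith F).B (A := X.base) (B := (Ψ.functor.obj X).base) (η.hom.app X)
                (ᾱ X.base (ModelFrobenioid.unit g)) =
            ModelFrobenioid.unit (Ψ.functor.map g) *
              pull (GlobalDivisorData.arith F).B (A := X.base) (B := (Ψ.functor.obj X).base) (η.hom.app X)
                (ᾱ X.base (ModelFrobenioid.unit f)) :=
  model_exists_unitsAut_of_overBase (GlobalDivisorData.arith F) (GlobalDivisorData.isFrobenioid_arith F)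
    (GlobalDivisorData.isOfStandardType_arith F) (GlobalDivisorData.objectwise_isPerfFactorial_arith F)
    (GlobalDivisorData.isRational_biratData_arith F) (GlobalDivisorData.arith_isGroupLike F)
    (GlobalDivisorData.arith_isDivisorial F) Ψ (GlobalDivisorData.cor411Setting_arith F F Ψ)
    (GlobalDivisorData.preservesDegFr_arith F F Ψ) η

/-! ### § 1⊚. The same at the WHISKERED arithmetic data `(Φ ∘ S, 𝔹 ∘ S, Div ∘ S)` over `ℬ(H)⁰`, `H` slim (the `⊚`-slot) -/

/-- **The categorical half of 𝔹-RATIO⊚**: for the model Frobenioid of the whiskered arithmetic data `(Φ^⊛ ∘ S, 𝔹 ∘ S, Div ∘ S)`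
over `ℬ(H)⁰` (`S : ℬ(H)⁰ → FinSubextCat F F̄` ANY functor, `H` slim — the carrier of the `hB` binder of ★ `Cor53iFcircHkerTransport`
for the «resp. `⊚`» clause of Cor 5.3 (i)), every self-equivalence `Ψ` over the base through `η` acts on the rational functions
through ONE natural automorphism `ᾱ` of `𝔹 ∘ S` (natural along `ℬ(H)⁰`; Div-compatible through monoid automorphisms of
`EffArithDivisor((S A).L)`; the (hratio) clause of `hB⊚` with `ᾱ` inserted), NO further hypothesis — every [FrdI] input from this
seat's ★ `GlobalFrobenioidsArithmeticWhiskeredCor411` (`…_whisker`).  HONEST LIMIT: the number-theoretic half («such an `ᾱ` is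
`1`») is Galois rigidity over `FinSubextCat F F̄`; along an `S` that is not essentially surjective it is NOT claimed here.
([IUTchI] Cor 5.3 (i) p.144; Ex 5.1 (v) p.128) [cite: MochizukiFrdI2008, Prop. 1.6 p.27] [claim: Mochizuki2012, status: disputed] -/
theorem whisker_exists_unitsAut_of_overBase {H : ProfiniteGrp.{0}} (S : BaseCat H ⥤ FinSubextCat F (Fbar F))
    (hZ : IsSlimGroup H)
    (Ψ : (GlobalDivisorData.mk (S.op ⋙ arithDivisorFunctor F (Fbar F)) (S.op ⋙ unitsFunctor F (Fbar F))
        (Functor.whiskerLeft S.op (divNatTrans F (Fbar F))) : GlobalDivisorData H).ModelGlobalFrobenioid ≌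
      (GlobalDivisorData.mk (S.op ⋙ arithDivisorFunctor F (Fbar F)) (S.op ⋙ unitsFunctor F (Fbar F))
        (Functor.whiskerLeft S.op (divNatTrans F (Fbar F))) : GlobalDivisorData H).ModelGlobalFrobenioid)
    (η : Ψ.functor ⋙ (GlobalDivisorData.mk (S.op ⋙ arithDivisorFunctor F (Fbar F)) (S.op ⋙ unitsFunctor F (Fbar F))
        (Functor.whiskerLeft S.op (divNatTrans F (Fbar F))) : GlobalDivisorData H).modelBase ≅
      (GlobalDivisorData.mk (S.op ⋙ arithDivisorFunctor F (Fbar F)) (S.op ⋙ unitsFunctor F (Fbar F))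
        (Functor.whiskerLeft S.op (divNatTrans F (Fbar F))) : GlobalDivisorData H).modelBase) :
    ∃ ᾱ : ∀ A : BaseCat H, (S.op ⋙ unitsFunctor F (Fbar F)).obj (op A) ≃* (S.op ⋙ unitsFunctor F (Fbar F)).obj (op A),
      (∀ ⦃A' A : BaseCat H⦄ (g : A' ⟶ A) (w : (S.op ⋙ unitsFunctor F (Fbar F)).obj (op A)),
        ᾱ A' (pull (S.op ⋙ unitsFunctor F (Fbar F)) g w) = pull (S.op ⋙ unitsFunctor F (Fbar F)) g (ᾱ A w)) ∧
      (∀ A : BaseCat H, ∃ ε : (S.op ⋙ arithDivisorFunctor F (Fbar F)).obj (op A) ≃* (S.op ⋙ arithDivisorFunctor F (Fbar F)).obj (op A),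
        ∀ w : (S.op ⋙ unitsFunctor F (Fbar F)).obj (op A),
          divB (S.op ⋙ arithDivisorFunctor F (Fbar F)) (S.op ⋙ unitsFunctor F (Fbar F))
              (Functor.whiskerLeft S.op (divNatTrans F (Fbar F))) (op A) (ᾱ A w) =
            MonGp.map ε.toMonoidHom (divB (S.op ⋙ arithDivisorFunctor F (Fbar F)) (S.op ⋙ unitsFunctor F (Fbar F))
              (Functor.whiskerLeft S.op (divNatTrans F (Fbar F))) (op A) w)) ∧
      ∀ ⦃X Y : (GlobalDivisorData.mk (S.op ⋙ arithDivisorFunctor F (Fbar F)) (S.op ⋙ unitsFunctor F (Fbar F))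
        (Functor.whiskerLeft S.op (divNatTrans F (Fbar F))) : GlobalDivisorData H).ModelGlobalFrobenioid⦄ (f g : X ⟶ Y),
        ModelFrobenioid.degFr f = 1 → ModelFrobenioid.degFr g = 1 → ModelFrobenioid.baseMap f = ModelFrobenioid.baseMap g →
          ModelFrobenioid.unit (Ψ.functor.map f) *
              pull (S.op ⋙ unitsFunctor F (Fbar F)) (A := X.base) (B := (Ψ.functor.obj X).base) (η.hom.app X)
                (ᾱ X.base (ModelFrobenioid.unit g)) =
            ModelFrobenioid.unit (Ψ.functor.map g) *
              pull (S.op ⋙ unitsFunctor F (Fbar F)) (A := X.base) (B := (Ψ.functor.obj X).base) (η.hom.app X)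
                (ᾱ X.base (ModelFrobenioid.unit f)) :=
  model_exists_unitsAut_of_overBase _ (GlobalDivisorData.isFrobenioid_whisker F S)
    (GlobalDivisorData.isOfStandardType_whisker F S) (GlobalDivisorData.objectwise_isPerfFactorial_whisker F S)
    (GlobalDivisorData.isRational_biratData_whisker F S) (GlobalDivisorData.hypotheses_whisker F S).isGroupLike_rat
    (GlobalDivisorData.hypotheses_whisker F S).isDivisorial Ψ (GlobalDivisorData.cor411Setting_whisker F S S hZ hZ Ψ)
    (GlobalDivisorData.preservesDegFr_whisker F S S hZ hZ Ψ) η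

/-! ### § 2. The divisor law read on the finite primes -/

/-- **The same `ᾱ`, with its finite-prime reading**: in addition to (1)–(3), at every `A ∈ Ob(ℬ(G_F)⁰)` there is a
PERMUTATION `π_A` of the finite places of the number field `K_A = F̄^{H_A}` such that `ord_{π_A w}(ᾱ_A u) = ord_w(u)` for all
`u ∈ K_A^×` (the Div-law (2) read through the structure theorem for monoid automorphisms of `EffArithDivisor(K_A)`:
`ε(f, t) = (π_* f, g t)`; `Div = gpEquiv⁻¹ ∘ div` at the model, [FrdI] Ex 6.3).  These are, at every `A` (in particular at the
one-point `G_F`-set, `K_A = F`), the hypotheses of the classical rigidity «BRIGID-KUMMER» (abc-iut-L5-t16).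
([IUTchI] Cor 5.3 (i) p.144; Ex 5.1 (v) p.128) [cite: MochizukiFrdI2008, Ex. 6.3 p.113] [claim: Mochizuki2012, status: disputed] -/
theorem arith_exists_unitsAut_ordFin_of_overBase
    (Ψ : (GlobalDivisorData.arith F).ModelGlobalFrobenioid ≌ (GlobalDivisorData.arith F).ModelGlobalFrobenioid)
    (η : Ψ.functor ⋙ (GlobalDivisorData.arith F).modelBase ≅ (GlobalDivisorData.arith F).modelBase) :
    ∃ ᾱ : ∀ A : BaseCat (absGalGrp F), (GlobalDivisorData.arith F).B.obj (op A) ≃* (GlobalDivisorData.arith F).B.obj (op A),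
      (∀ ⦃A' A : BaseCat (absGalGrp F)⦄ (g : A' ⟶ A) (w : (GlobalDivisorData.arith F).B.obj (op A)),
        ᾱ A' (pull (GlobalDivisorData.arith F).B g w) = pull (GlobalDivisorData.arith F).B g (ᾱ A w)) ∧
      (∀ A : BaseCat (absGalGrp F),
        ∃ ε : (GlobalDivisorData.arith F).Φ.obj (op A) ≃* (GlobalDivisorData.arith F).Φ.obj (op A),
          ∀ w : (GlobalDivisorData.arith F).B.obj (op A),
            divB (GlobalDivisorData.arith F).Φ (GlobalDivisorData.arith F).B (GlobalDivisorData.arith F).div (op A) (ᾱ A w) =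
              MonGp.map ε.toMonoidHom
                (divB (GlobalDivisorData.arith F).Φ (GlobalDivisorData.arith F).B (GlobalDivisorData.arith F).div (op A) w)) ∧
      (∀ A : BaseCat (absGalGrp F), ∃ π : Equiv.Perm (FinitePlace ((galoisSubextOfFinite F).obj A).L),
        ∀ (u : (GlobalDivisorData.arith F).B.obj (op A)) (w : FinitePlace ((galoisSubextOfFinite F).obj A).L),
          ordFin ((galoisSubextOfFinite F).obj A).L (π w) (ᾱ A u) = ordFin ((galoisSubextOfFinite F).obj A).L w u) ∧
      ∀ ⦃X Y : (GlobalDivisorData.arith F).ModelGlobalFrobenioid⦄ (f g : X ⟶ Y), ModelFrobenioid.degFr f = 1 →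
        ModelFrobenioid.degFr g = 1 → ModelFrobenioid.baseMap f = ModelFrobenioid.baseMap g →
          ModelFrobenioid.unit (Ψ.functor.map f) *
              pull (GlobalDivisorData.arith F).B (A := X.base) (B := (Ψ.functor.obj X).base) (η.hom.app X)
                (ᾱ X.base (ModelFrobenioid.unit g)) =
            ModelFrobenioid.unit (Ψ.functor.map g) *
              pull (GlobalDivisorData.arith F).B (A := X.base) (B := (Ψ.functor.obj X).base) (η.hom.app X)
                (ᾱ X.base (ModelFrobenioid.unit f)) := by
  obtain ⟨ᾱ, hnat, hdiv, hratio⟩ := arith_exists_unitsAut_of_overBase F Ψ η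
  refine ⟨ᾱ, hnat, hdiv, fun A => ?_, hratio⟩
  obtain ⟨ε, hε⟩ := hdiv A
  exact EffArithDivisor.exists_perm_ordFin_of_divisor_law ε (fun u => ᾱ A u) hε

/-! ### § 3. The same `ᾱ` as ONE natural endomorphism of the functor `𝔹 = (A ↦ (F̄^{H_A})^×)` -/

/-- **𝔹-RATIO, categorical half, in NATURAL-TRANSFORMATION form**: for every `Ψ` over the identity of `†𝒟^⊛` (through `η`)
there is a natural endomorphism `α : 𝔹 ⟶ 𝔹` of the rational-function monoid `𝔹 = (A ↦ (F̄^{H_A})^×)` on `ℬ(G_F)⁰` (objectwise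
bijective), `Div`-compatible at every `A` through a monoid automorphism of `Φ^⊛(A)`, with
`u_{Ψ f} · η_X^*(α(u_g)) = u_{Ψ g} · η_X^*(α(u_f))` for all parallel linear `f, g` — the input shape of abc-iut-L5-t16's ★
`unitsFunctor_natEnd_eq_id_of_divB_compat` («such an `α` is `𝟙`», [FrdI] Ex 6.3 classical), transported to `ℬ(G_F)⁰`.
([IUTchI] Cor 5.3 (i) p.144; Ex 5.1 (v) p.128) [cite: MochizukiFrdI2008, Cor. 4.10 p.90] [claim: Mochizuki2012, status: disputed] -/
theorem arith_exists_unitsNatEnd_of_overBase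
    (Ψ : (GlobalDivisorData.arith F).ModelGlobalFrobenioid ≌ (GlobalDivisorData.arith F).ModelGlobalFrobenioid)
    (η : Ψ.functor ⋙ (GlobalDivisorData.arith F).modelBase ≅ (GlobalDivisorData.arith F).modelBase) :
    ∃ α : (GlobalDivisorData.arith F).B ⟶ (GlobalDivisorData.arith F).B,
      (∀ A : BaseCat (absGalGrp F), Function.Bijective (α.app (op A)).hom) ∧
      (∀ A : BaseCat (absGalGrp F),
        ∃ ε : (GlobalDivisorData.arith F).Φ.obj (op A) ≃* (GlobalDivisorData.arith F).Φ.obj (op A),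
          ∀ w : (GlobalDivisorData.arith F).B.obj (op A),
            divB (GlobalDivisorData.arith F).Φ (GlobalDivisorData.arith F).B (GlobalDivisorData.arith F).div (op A)
                ((α.app (op A)).hom w) =
              MonGp.map ε.toMonoidHom
                (divB (GlobalDivisorData.arith F).Φ (GlobalDivisorData.arith F).B (GlobalDivisorData.arith F).div (op A) w)) ∧
      ∀ ⦃X Y : (GlobalDivisorData.arith F).ModelGlobalFrobenioid⦄ (f g : X ⟶ Y), ModelFrobenioid.degFr f = 1 →
        ModelFrobenioid.degFr g = 1 → ModelFrobenioid.baseMap f = ModelFrobenioid.baseMap g →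
          ModelFrobenioid.unit (Ψ.functor.map f) *
              pull (GlobalDivisorData.arith F).B (A := X.base) (B := (Ψ.functor.obj X).base) (η.hom.app X)
                ((α.app (op X.base)).hom (ModelFrobenioid.unit g)) =
            ModelFrobenioid.unit (Ψ.functor.map g) *
              pull (GlobalDivisorData.arith F).B (A := X.base) (B := (Ψ.functor.obj X).base) (η.hom.app X)
                ((α.app (op X.base)).hom (ModelFrobenioid.unit f)) := by
  obtain ⟨ᾱ, hnat, hdiv, hratio⟩ := arith_exists_unitsAut_of_overBase F Ψ η
  refine ⟨{ app := fun A => CommMonCat.ofHom (ᾱ A.unop).toMonoidHom, naturality := fun A A' g => ?_ },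
    fun A => (ᾱ A).bijective, fun A => hdiv A, fun X Y f g hf hg hfg => hratio f g hf hg hfg⟩
  apply CommMonCat.hom_ext
  refine MonoidHom.ext fun w => ?_
  rw [CommMonCat.hom_comp, CommMonCat.hom_comp, CommMonCat.hom_ofHom, CommMonCat.hom_ofHom, MonoidHom.comp_apply,
    MonoidHom.comp_apply]
  exact hnat g.unop w

end Arith

end Cor53

end Literature.IUT.HodgeTheaters

end
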